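import Summits.Ventures.HodgeRepro.Tier4.Line1.RTFSetting

/-!
# Tier4/Line1/KernelUnfold — LINE L1: unfolding over the fundamental domain and the kernel identities (t4-L1-p3)

Blind re-derivation cell `pub-hodge-repro`, Tier 4 (README §9–§10), seat t4-L1-p3.  The generic tools behind the
line's lemma L1.2a `kernel_spectral` (module `Tier4/Line1/KernelSpectral.lean`), over every `RTF.Setting G`
(Mathlib only, no printed input):
* (T1) `finite_rational_of_isCompact`: `G(k)` is discrete and closed, so only finitely many rational points lie in
  a compact set.
* (T2) `integral_eq_sum_setIntegral` / `integral_eq_setIntegral_tsum`: UNFOLDING `∫_G H = ∫_{DG} ∑_{γ ∈ G(k)} H(γw)`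
  for `H` continuous with compact support.  Mathlib's `IsFundamentalDomain.integral_eq_tsum` needs `[Countable G(k)]`,
  which a `Setting` does not provide (`G = ℝ × D` with `D` an uncountable discrete group, `G(k) = ℤ × D`,
  `DG = [0,1) × {1}` is a `Setting`), so the unfolding is proved through the FINITE family of translates
  `γ • closure DG` meeting the support of `H` (by (T1)), the a.e. covering and a.e. disjointness of the fundamental
  domain (`Measure.restrict_iUnion_ae`) and the left invariance of the Haar measure.
* `kernel_mul_left`: left `G(k)`-invariance of the kernel in its first variable; `kernel_left_memLp`,
  `kernel_right_memLp`, `memLp_of_inner_self_eq_one`: the kernel sections and the orthonormal vectors are in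
  `L²(DG, μ)`.
* (T3a), (T3b) `R_cj_eq`, `R_refl_eq`: `(R(f̄)φ)(x) = ∫_{DG} conj K_f(x, w) φ(w) dw` and
  `(R(fˇ)φ)(y) = ∫_{DG} K_f(w, y) φ(w) dw` for continuous invariant `φ` — one left-invariant substitution, (T2), and
  the invariance of `φ`.

Nothing here says anything about the status of the Hodge conjecture for CM abelian varieties, which is NOT proved
(HC_CM is NOT proved by anyone in this repository).
-/

set_option autoImplicit false

noncomputable section

namespace Summit.Ventures.HodgeRepro.Tier4.Line1.RTF.Setting

open MeasureTheory Topology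
open scoped InnerProductSpace Pointwise

variable {G : Type} [Group G] [TopologicalSpace G] [IsTopologicalGroup G] [MeasurableSpace G]
  [BorelSpace G]

variable (S : Setting G)

omit [IsTopologicalGroup G] [BorelSpace G] in
/-- (T1) `G(k)` is discrete and closed in `G`, so only finitely many rational points lie in a compact set. -/
theorem finite_rational_of_isCompact {M : Set G} (hM : IsCompact M) :
    {γ : S.Gk | (γ : G) ∈ M}.Finite := by
  haveI := S.discrete
  have hemb : Topology.IsClosedEmbedding (Subtype.val : S.Gk → G) :=
    S.closed.isClosedEmbedding_subtypeVal
  exact (hemb.isCompact_preimage hM).finite_of_discrete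

omit [IsTopologicalGroup G] [BorelSpace G] in
/-- `DG` has finite measure (its closure is compact and `μ` is a Haar measure). -/
theorem isFiniteMeasure_restrict_DG : IsFiniteMeasure (S.μ.restrict S.DG) := by
  haveI := S.haar
  exact isFiniteMeasure_restrict.mpr
    ((measure_mono subset_closure).trans_lt S.compG.measure_lt_top).ne

omit [IsTopologicalGroup G] in
/-- a continuous function on `G` is in `L²(DG, μ)` (bounded on the compact closure; finite measure). -/
theorem memLp_restrict_of_continuous {H : G → ℂ} (hc : Continuous H) :
    MemLp H 2 (S.μ.restrict S.DG) := by
  haveI := S.isFiniteMeasure_restrict_DG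
  obtain ⟨C, hC⟩ := S.compG.exists_bound_of_continuousOn hc.continuousOn
  refine MemLp.of_bound hc.aestronglyMeasurable C ?_
  filter_upwards [ae_restrict_mem₀ S.fdG.nullMeasurableSet] with w hw
  exact hC w (subset_closure hw)

/-- (T2, finite form) unfolding along the fundamental domain: if every translate `γ • closure DG` meeting the
support of the continuous compactly supported `H` has `γ ∈ Γ`, then `∫_G H = ∑_{γ ∈ Γ} ∫_{DG} H(γ w)`. -/
theorem integral_eq_sum_setIntegral {H : G → ℂ} (hc : Continuous H) (hs : HasCompactSupport H)
    (Γ : Finset S.Gk) (hΓ : ∀ γ : S.Gk, ∀ w ∈ closure S.DG, H (γ * w) ≠ 0 → γ ∈ Γ) :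
    ∫ w, H w ∂S.μ = ∑ γ ∈ Γ, ∫ w in S.DG, H (γ * w) ∂S.μ := by
  haveI := S.haar
  have hint : Integrable H S.μ := hc.integrable_of_hasCompactSupport hs
  have hsm : ∀ (g : S.Gk) (w : G), g • w = (g : G) * w := fun _ _ => rfl
  have hmem : ∀ (γ : S.Gk) (w : G), w ∈ γ • S.DG ↔ (γ : G)⁻¹ * w ∈ S.DG := by
    intro γ w
    rw [Set.mem_smul_set_iff_inv_smul_mem]
    rfl
  -- the finite union of translates carrying the support of `H`
  set U : Set G := ⋃ γ : Γ, ((γ : S.Gk) • S.DG) with hU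
  have h1 : ∫ w, H w ∂S.μ = ∫ w in U, H w ∂S.μ := by
    symm
    apply setIntegral_eq_integral_of_ae_compl_eq_zero
    filter_upwards [S.fdG.ae_covers] with w hw hwU
    by_contra hH
    obtain ⟨g, hg⟩ := hw
    have hg' : (g : G) * w ∈ S.DG := hg
    have hmemΓ : g⁻¹ ∈ Γ := by
      apply hΓ g⁻¹ (g • w) (subset_closure hg)
      rw [hsm]
      simpa using hH
    apply hwU
    rw [hU]
    refine Set.mem_iUnion.mpr ⟨⟨g⁻¹, hmemΓ⟩, ?_⟩
    rw [hmem]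
    simpa using hg'
  have hnull : ∀ γ : S.Gk, NullMeasurableSet (γ • S.DG) S.μ := by
    intro γ
    have : γ • S.DG = (fun w => (γ : G)⁻¹ * w) ⁻¹' S.DG := by
      ext w
      exact hmem γ w
    rw [this]
    exact S.fdG.nullMeasurableSet.preimage
      (measurePreserving_mul_left S.μ (γ : G)⁻¹).quasiMeasurePreserving
  have h2 : S.μ.restrict U = Measure.sum (fun γ : Γ => S.μ.restrict ((γ : S.Gk) • S.DG)) := by
    rw [hU]
    exact Measure.restrict_iUnion_ae
      (fun a b hab => S.fdG.aedisjoint (Subtype.coe_ne_coe.mpr hab)) (fun a => hnull a)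
  have h3 : ∫ w in U, H w ∂S.μ = ∑ γ ∈ Γ, ∫ w in (γ • S.DG), H w ∂S.μ := by
    have hi : Integrable H (Measure.sum (fun γ : Γ => S.μ.restrict ((γ : S.Gk) • S.DG))) := by
      rw [← h2]
      exact hint.mono_measure Measure.restrict_le_self
    rw [h2, integral_sum_measure hi, tsum_fintype]
    exact Finset.sum_coe_sort Γ (fun γ => ∫ w in (γ • S.DG), H w ∂S.μ)
  have h4 : ∀ γ : S.Gk, ∫ w in (γ • S.DG), H w ∂S.μ = ∫ w in S.DG, H (γ * w) ∂S.μ := by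
    intro γ
    have hpre : (fun w : G => (γ : G) * w) ⁻¹' (γ • S.DG) = S.DG := by
      ext w
      simp only [Set.mem_preimage, hmem, inv_mul_cancel_left]
    rw [← (measurePreserving_mul_left S.μ (γ : G)).setIntegral_preimage_emb
      (MeasurableEquiv.mulLeft (γ : G)).measurableEmbedding H (γ • S.DG), hpre]
  rw [h1, h3]
  exact Finset.sum_congr rfl (fun γ _ => h4 γ)

/-- (T2) unfolding along the fundamental domain with the full sum over `G(k)`:
`∫_G H = ∫_{DG} ∑_{γ ∈ G(k)} H(γ w)` for `H` continuous with compact support. -/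
theorem integral_eq_setIntegral_tsum {H : G → ℂ} (hc : Continuous H) (hs : HasCompactSupport H) :
    ∫ w, H w ∂S.μ = ∫ w in S.DG, ∑' γ : S.Gk, H (γ * w) ∂S.μ := by
  haveI := S.haar
  have hM : IsCompact ((fun p : G × G => p.1 * p.2⁻¹) '' (tsupport H ×ˢ closure S.DG)) :=
    (hs.prod S.compG).image (by fun_prop)
  obtain hfin := S.finite_rational_of_isCompact hM
  set Γ := hfin.toFinset with hΓdef
  have hΓ : ∀ γ : S.Gk, ∀ w ∈ closure S.DG, H (γ * w) ≠ 0 → γ ∈ Γ := by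
    intro γ w hw hne
    rw [hΓdef, Set.Finite.mem_toFinset]
    refine ⟨((γ : G) * w, w), ⟨subset_tsupport _ hne, hw⟩, ?_⟩
    simp
  rw [S.integral_eq_sum_setIntegral hc hs Γ hΓ]
  have hint : ∀ γ ∈ Γ, Integrable (fun w => H ((γ : G) * w)) (S.μ.restrict S.DG) := by
    intro γ _
    exact ((hc.comp (continuous_const.mul continuous_id)).integrable_of_hasCompactSupport
      (hs.comp_homeomorph (Homeomorph.mulLeft (γ : G)))).integrableOn
  rw [← integral_finsetSum Γ hint]
  apply setIntegral_congr_fun₀ S.fdG.nullMeasurableSet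
  intro w hw
  symm
  apply tsum_eq_sum
  intro γ hγ
  by_contra hne
  exact hγ (hΓ γ w (subset_closure hw) hne)

omit [IsTopologicalGroup G] [BorelSpace G] in
/-- left `G(k)`-invariance of the kernel in its first variable (re-index the sum by `γ ↦ δ γ`). -/
theorem kernel_mul_left (f : G → ℂ) (δ : S.Gk) (w y : G) :
    S.kernel f ((δ : G) * w) y = S.kernel f w y := by
  unfold kernel
  rw [← (Equiv.mulLeft δ).tsum_eq]
  apply tsum_congr
  intro γ
  simp only [Equiv.coe_mulLeft, Subgroup.coe_mul]
  congr 1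
  group

omit [IsTopologicalGroup G] in
/-- a continuous `ψ` with `⟨ψ, ψ⟩ = 1` is in `L²(DG, μ)`: the Bochner integral of a non-integrable function is `0`,
so `|ψ|²` is integrable on `DG`. -/
theorem memLp_of_inner_self_eq_one {ψ : G → ℂ} (hc : Continuous ψ) (h : S.inner ψ ψ = 1) :
    MemLp ψ 2 (S.μ.restrict S.DG) := by
  have hint : Integrable (fun w => ψ w * starRingEnd ℂ (ψ w)) (S.μ.restrict S.DG) := by
    by_contra hn
    have h0 : S.inner ψ ψ = 0 := integral_undef hn
    rw [h0] at h
    exact zero_ne_one h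
  rw [memLp_two_iff_integrable_sq_norm hc.aestronglyMeasurable]
  refine hint.re.congr (Filter.Eventually.of_forall fun w => ?_)
  simp only [Complex.mul_conj, Complex.normSq_eq_norm_sq, RCLike.re_to_complex, Complex.ofReal_re]

/-- `K_f(x, ·)` is in `L²(DG, μ)`: on `closure DG` only finitely many rational `γ` contribute (T1), so there it is
a finite sum of continuous functions. -/
theorem kernel_left_memLp {f : G → ℂ} (hf : IsTest f) (x : G) :
    MemLp (fun w => S.kernel f x w) 2 (S.μ.restrict S.DG) := by
  have hM : IsCompact ((fun p : G × G => x * p.1 * p.2⁻¹) '' (tsupport f ×ˢ closure S.DG)) :=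
    (hf.compact.prod S.compG).image (by fun_prop)
  obtain hfin := S.finite_rational_of_isCompact hM
  set Γ := hfin.toFinset with hΓdef
  have hΓ : ∀ γ : S.Gk, ∀ w ∈ closure S.DG, f (x⁻¹ * γ * w) ≠ 0 → γ ∈ Γ := by
    intro γ w hw hne
    rw [hΓdef, Set.Finite.mem_toFinset]
    refine ⟨(x⁻¹ * γ * w, w), ⟨subset_tsupport _ hne, hw⟩, ?_⟩
    simp only
    group
  have hG : Continuous (fun w => ∑ γ ∈ Γ, f (x⁻¹ * γ * w)) :=
    continuous_finsetSum _ (fun γ _ => hf.cont.comp (continuous_const.mul continuous_id))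
  refine (S.memLp_restrict_of_continuous hG).ae_eq ?_
  filter_upwards [ae_restrict_mem₀ S.fdG.nullMeasurableSet] with w hw
  unfold kernel
  symm
  apply tsum_eq_sum
  intro γ hγ
  by_contra hne
  exact hγ (hΓ γ w (subset_closure hw) hne)

/-- `K_f(·, y)` is in `L²(DG, μ)` (same argument as `kernel_left_memLp`). -/
theorem kernel_right_memLp {f : G → ℂ} (hf : IsTest f) (y : G) :
    MemLp (fun w => S.kernel f w y) 2 (S.μ.restrict S.DG) := by
  have hM : IsCompact ((fun p : G × G => p.1 * p.2 * y⁻¹) '' (closure S.DG ×ˢ tsupport f)) :=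
    (S.compG.prod hf.compact).image (by fun_prop)
  obtain hfin := S.finite_rational_of_isCompact hM
  set Γ := hfin.toFinset with hΓdef
  have hΓ : ∀ γ : S.Gk, ∀ w ∈ closure S.DG, f (w⁻¹ * γ * y) ≠ 0 → γ ∈ Γ := by
    intro γ w hw hne
    rw [hΓdef, Set.Finite.mem_toFinset]
    refine ⟨(w, w⁻¹ * γ * y), ⟨hw, subset_tsupport _ hne⟩, ?_⟩
    simp only
    group
  have hG : Continuous (fun w => ∑ γ ∈ Γ, f (w⁻¹ * γ * y)) :=
    continuous_finsetSum _ (fun γ _ => hf.cont.comp (by fun_prop))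
  refine (S.memLp_restrict_of_continuous hG).ae_eq ?_
  filter_upwards [ae_restrict_mem₀ S.fdG.nullMeasurableSet] with w hw
  unfold kernel
  symm
  apply tsum_eq_sum
  intro γ hγ
  by_contra hne
  exact hγ (hΓ γ w (subset_closure hw) hne)

/-- (T3a) the action of the conjugate test function `f̄` on a continuous invariant `φ`, unfolded over `DG`:
`(R(f̄)φ)(x) = ∫_{DG} conj K_f(x, w) · φ(w) dw`. -/
theorem R_cj_eq {f : G → ℂ} (hf : IsTest f) {φ : G → ℂ} (hφc : Continuous φ)
    (hφ : S.Invariant φ) (x : G) :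
    S.R (cj f) φ x = ∫ w in S.DG, starRingEnd ℂ (S.kernel f x w) * φ w ∂S.μ := by
  haveI := S.haar
  have h1 : S.R (cj f) φ x = ∫ w, starRingEnd ℂ (f (x⁻¹ * w)) * φ w ∂S.μ := by
    unfold R cj
    have := integral_mul_left_eq_self (μ := S.μ) (fun g => starRingEnd ℂ (f g) * φ (x * g)) x⁻¹
    simp only [mul_inv_cancel_left] at this
    exact this.symm
  have hc : Continuous (fun w => starRingEnd ℂ (f (x⁻¹ * w)) * φ w) :=
    (Complex.continuous_conj.comp (hf.cont.comp (continuous_const.mul continuous_id))).mul hφc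
  have hs : HasCompactSupport (fun w => starRingEnd ℂ (f (x⁻¹ * w)) * φ w) :=
    ((hf.compact.comp_homeomorph (Homeomorph.mulLeft x⁻¹)).comp_left
      (map_zero (starRingEnd ℂ))).mul_right
  rw [h1, S.integral_eq_setIntegral_tsum hc hs]
  apply setIntegral_congr_fun₀ S.fdG.nullMeasurableSet
  intro w _
  simp only
  unfold kernel
  rw [Complex.conj_tsum, ← tsum_mul_right]
  apply tsum_congr
  intro γ
  rw [hφ γ w, mul_assoc]

/-- (T3b) the action of the reflected test function `fˇ` on a continuous invariant `φ`, unfolded over `DG`: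
`(R(fˇ)φ)(y) = ∫_{DG} K_f(w, y) · φ(w) dw`. -/
theorem R_refl_eq {f : G → ℂ} (hf : IsTest f) {φ : G → ℂ} (hφc : Continuous φ)
    (hφ : S.Invariant φ) (y : G) :
    S.R (refl f) φ y = ∫ w in S.DG, S.kernel f w y * φ w ∂S.μ := by
  haveI := S.haar
  have h1 : S.R (refl f) φ y = ∫ w, f (w⁻¹ * y) * φ w ∂S.μ := by
    unfold R refl
    have := integral_mul_left_eq_self (μ := S.μ) (fun g => f g⁻¹ * φ (y * g)) y⁻¹
    simp only [mul_inv_rev, inv_inv, mul_inv_cancel_left] at this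
    exact this.symm
  have hc : Continuous (fun w => f (w⁻¹ * y) * φ w) :=
    (hf.cont.comp (continuous_inv.mul continuous_const)).mul hφc
  have hs : HasCompactSupport (fun w => f (w⁻¹ * y) * φ w) :=
    (hf.compact.comp_homeomorph ((Homeomorph.inv G).trans (Homeomorph.mulRight y))).mul_right
  rw [h1, S.integral_eq_setIntegral_tsum hc hs]
  apply setIntegral_congr_fun₀ S.fdG.nullMeasurableSet
  intro w _
  simp only
  unfold kernel
  rw [← (Equiv.inv S.Gk).tsum_eq (fun γ : S.Gk => f (w⁻¹ * γ * y)), ← tsum_mul_right]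
  apply tsum_congr
  intro γ
  rw [hφ γ w]
  simp only [Equiv.inv_apply, Subgroup.coe_inv]
  congr 2
  group

end Summit.Ventures.HodgeRepro.Tier4.Line1.RTF.Setting
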